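import Mathlib
import HarnessLib

/-!
# Scale mixing for finite-range decompositions (Buchholz's Proposition 3.1, the algebra)

Topic `Literature/MathematicalPhysics/StatisticalMechanics`.  The scale-mixing step of Buchholz,
J. Funct. Anal. 275 (2018), Prop 3.1: from a decomposition `c_1, …, c_{N+1}` one forms
`𝒟_k = Σ_{j ≤ k} λ_{k,j} c_j` with `λ_{k,j} = L^{-(k-j)γ}` (`j < k`, `γ = d − 1 + n`) and `λ_{k,k}`
defined by `Σ_{l=k}^{N+1} λ_{l,k} = 1` (so `λ_{k,k} ∈ [1/2, 1]`).  This file is the bookkeeping, for real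
sequences indexed by the scale and a real base `L ≥ 5`:

* `mixCoeff`, `mix`; `mixCoeff_nonneg`, `half_le_mixCoeff_self`, `mixCoeff_le_inv_pow`;
* `sum_mix` — `Σ_k 𝒟_k = Σ_j c_j` (the mixed family is again a decomposition);
* `mix_nonneg`, `mixCoeff_mul_le_mix` — positivity and the lower bounds `𝒟_k ≥ λ_{k,j} c_j`;
* `abs_mix_le_geom` — `|c_j| ≤ U L^{2j}` for `j ≤ k` implies `|𝒟_k| ≤ 2U L^{2k}` (Buchholz (3.13));
* `abs_mix_le_decay` — the annulus estimate (3.14)–(3.16): if moreover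
  `|c_{k'}| ≤ U x^{-2} (x L^{k'-1})^{-(γ+1)}` and `x > L^{-j₀-1}` with `j₀ < k`, then
  `|𝒟_k| ≤ 4U L^{2γ+3} L^{2j₀} L^{-(k-j₀)γ}`.

Everything is proved; no named facts.

## References
* S. Buchholz, *Finite range decomposition for Gaussian measures with improved regularity*,
  J. Funct. Anal. 275 (2018), Prop 3.1 and its proof, (3.8)–(3.16) [Buchholz2016].
-/

noncomputable section

open Finset
open scoped BigOperators

namespace Literature.MathematicalPhysics.StatisticalMechanics.GradientFRD

/-! ## The coefficients -/

/-- The tail sum `Σ_{l=k+1}^{N+1} L^{-(l-k)γ}` defining `λ_{k,k} = 1 − (tail)`. [cite: Buchholz2016, Prop 3.1 (proof, (3.8))] -/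
def mixTail (L : ℝ) (γ N k : ℕ) : ℝ := ∑ l ∈ Finset.Icc (k + 1) (N + 1), (L ^ ((l - k) * γ))⁻¹

/-- The mixing coefficients `λ_{k,j}`: `L^{-(k-j)γ}` for `j < k`, `1 − Σ_{l>k} λ_{l,k}` for `j = k`, `0` for
`j > k`. [cite: Buchholz2016, Prop 3.1 (proof, (3.8))] -/
def mixCoeff (L : ℝ) (γ N k j : ℕ) : ℝ :=
  if j < k then (L ^ ((k - j) * γ))⁻¹ else if j = k then 1 - mixTail L γ N k else 0

/-- The mixed decomposition `𝒟_k = Σ_{j=1}^k λ_{k,j} c_j`. [cite: Buchholz2016, Prop 3.1 (3.8)] -/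
def mix (L : ℝ) (γ N : ℕ) (c : ℕ → ℝ) (k : ℕ) : ℝ := ∑ j ∈ Finset.Icc 1 k, mixCoeff L γ N k j * c j

/-- `λ_{k,j} = L^{-(k-j)γ}` for `j < k`. [cite: Buchholz2016, Prop 3.1 (proof)] -/
theorem mixCoeff_of_lt (L : ℝ) (γ N : ℕ) {k j : ℕ} (h : j < k) : mixCoeff L γ N k j = (L ^ ((k - j) * γ))⁻¹ := by
  rw [mixCoeff, if_pos h]

/-- `λ_{k,k} = 1 − Σ_{l>k} λ_{l,k}`. [cite: Buchholz2016, Prop 3.1 (proof)] -/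
theorem mixCoeff_self (L : ℝ) (γ N k : ℕ) : mixCoeff L γ N k k = 1 - mixTail L γ N k := by
  rw [mixCoeff, if_neg (lt_irrefl k), if_pos rfl]

/-- A geometric bound: `Σ_{i<n} r^i ≤ 2` for `0 ≤ r ≤ 1/2`. [cite: Buchholz2016, Prop 3.1 (proof, "geometric series by 2")] -/
theorem geom_sum_le_two {r : ℝ} (hr0 : 0 ≤ r) (hr : r ≤ 1 / 2) (n : ℕ) : ∑ i ∈ Finset.range n, r ^ i ≤ 2 := by
  have hr1 : r < 1 := by linarith
  rw [geom_sum_eq hr1.ne n]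
  rw [div_le_iff_of_neg (by linarith)]
  have : 0 ≤ r ^ n := pow_nonneg hr0 n
  nlinarith

/-- The tail is small: `0 ≤ mixTail ≤ 1/2` for `L ≥ 5`, `γ ≥ 1`. [cite: Buchholz2016, Prop 3.1 (proof, "1 ≥ λ_{k,k} > 1/2")] -/
theorem mixTail_le_half {L : ℝ} (hL : 5 ≤ L) {γ : ℕ} (hγ : 1 ≤ γ) (N k : ℕ) : 0 ≤ mixTail L γ N k ∧ mixTail L γ N k ≤ 1 / 2 := by
  have hL1 : 1 ≤ L := by linarith
  unfold mixTail
  refine ⟨sum_nonneg fun l _ => by positivity, ?_⟩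
  -- compare with `Σ_{i=1}^{N+1-k} (1/5)^i ≤ (1/5) Σ_{i≥0} (1/5)^i ≤ 1/4 · ... ≤ 1/2`
  set r : ℝ := L⁻¹ with hr
  have hr0 : 0 ≤ r := by positivity
  have hr5 : r ≤ 1 / 5 := by rw [hr, inv_le_comm₀ (by linarith) (by norm_num)]; linarith
  have hterm : ∀ l ∈ Finset.Icc (k + 1) (N + 1), (L ^ ((l - k) * γ))⁻¹ ≤ r * r ^ (l - (k + 1)) := by
    intro l hl
    rw [Finset.mem_Icc] at hl
    rw [← pow_succ', show l - (k + 1) + 1 = l - k by omega, hr, inv_pow]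
    rw [inv_le_inv₀ (by positivity) (by positivity)]
    calc L ^ (l - k) ≤ L ^ ((l - k) * γ) := pow_le_pow_right₀ hL1 (Nat.le_mul_of_pos_right _ hγ)
      _ = L ^ ((l - k) * γ) := rfl
  calc ∑ l ∈ Finset.Icc (k + 1) (N + 1), (L ^ ((l - k) * γ))⁻¹
      ≤ ∑ l ∈ Finset.Icc (k + 1) (N + 1), r * r ^ (l - (k + 1)) := sum_le_sum hterm
    _ = r * ∑ l ∈ Finset.Icc (k + 1) (N + 1), r ^ (l - (k + 1)) := by rw [Finset.mul_sum]
    _ ≤ r * 2 := by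
        refine mul_le_mul_of_nonneg_left ?_ hr0
        rcases le_or_gt (k + 1) (N + 1) with hk | hk
        · rw [← Finset.Ico_add_one_right_eq_Icc, Finset.sum_Ico_eq_sum_range]
          have : ∑ i ∈ Finset.range (N + 1 + 1 - (k + 1)), r ^ (k + 1 + i - (k + 1)) =
              ∑ i ∈ Finset.range (N + 1 + 1 - (k + 1)), r ^ i :=
            sum_congr rfl fun i _ => by rw [show k + 1 + i - (k + 1) = i by omega]
          rw [this]
          exact geom_sum_le_two hr0 (by linarith) _
        · rw [Finset.Icc_eq_empty_of_lt hk, Finset.sum_empty]; norm_num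
    _ ≤ 1 / 2 := by linarith

/-- `1/2 ≤ λ_{k,k} ≤ 1`. [cite: Buchholz2016, Prop 3.1 (proof)] -/
theorem half_le_mixCoeff_self {L : ℝ} (hL : 5 ≤ L) {γ : ℕ} (hγ : 1 ≤ γ) (N k : ℕ) :
    1 / 2 ≤ mixCoeff L γ N k k ∧ mixCoeff L γ N k k ≤ 1 := by
  rw [mixCoeff_self]
  have h := mixTail_le_half hL hγ N k
  constructor <;> linarith [h.1, h.2]

/-- `λ_{k,j} ≥ 0`. [cite: Buchholz2016, Prop 3.1 (proof)] -/
theorem mixCoeff_nonneg {L : ℝ} (hL : 5 ≤ L) {γ : ℕ} (hγ : 1 ≤ γ) (N k j : ℕ) : 0 ≤ mixCoeff L γ N k j := by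
  unfold mixCoeff
  split_ifs with h1 h2
  · have : 0 < L := by linarith
    positivity
  · subst h2; have := (half_le_mixCoeff_self hL hγ N j).1; rw [mixCoeff_self] at this; linarith
  · exact le_rfl

/-- `λ_{k,j} ≤ L^{-(k-j)γ}` for all `j ≤ k` (with equality for `j < k`). [cite: Buchholz2016, Prop 3.1 (proof)] -/
theorem mixCoeff_le_inv_pow {L : ℝ} (hL : 5 ≤ L) {γ : ℕ} (hγ : 1 ≤ γ) (N : ℕ) {k j : ℕ} (hjk : j ≤ k) :
    mixCoeff L γ N k j ≤ (L ^ ((k - j) * γ))⁻¹ := by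
  rcases lt_or_eq_of_le hjk with h | h
  · rw [mixCoeff_of_lt L γ N h]
  · subst h
    rw [Nat.sub_self, zero_mul, pow_zero, inv_one]
    exact (half_le_mixCoeff_self hL hγ N j).2

/-- `λ_{k,j} = 0` for `j > k`. [cite: Buchholz2016, Prop 3.1 (proof)] -/
theorem mixCoeff_of_gt (L : ℝ) (γ N : ℕ) {k j : ℕ} (h : k < j) : mixCoeff L γ N k j = 0 := by
  rw [mixCoeff, if_neg (by omega), if_neg (by omega)]

/-! ## The mixed family is a decomposition -/

/-- The normalisation `Σ_{l=k}^{N+1} λ_{l,k} = 1` (`k ≤ N+1`). [cite: Buchholz2016, Prop 3.1 (proof, "Σ_{l=k}^{N+1} λ_{l,k} = 1")] -/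
theorem sum_mixCoeff_col (L : ℝ) (γ N : ℕ) {k : ℕ} (hk : k ≤ N + 1) :
    ∑ l ∈ Finset.Icc k (N + 1), mixCoeff L γ N l k = 1 := by
  rw [← Finset.Ico_add_one_right_eq_Icc, Finset.sum_eq_sum_Ico_succ_bot (by omega), mixCoeff_self,
    Finset.Ico_add_one_right_eq_Icc, mixTail]
  have : ∑ l ∈ Finset.Icc (k + 1) (N + 1), mixCoeff L γ N l k = ∑ l ∈ Finset.Icc (k + 1) (N + 1), (L ^ ((l - k) * γ))⁻¹ :=
    sum_congr rfl fun l hl => by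
      rw [Finset.mem_Icc] at hl
      exact mixCoeff_of_lt L γ N (by omega)
  rw [this]; ring

/-- **The mixed family sums to the same total**: `Σ_{k=1}^{N+1} 𝒟_k = Σ_{j=1}^{N+1} c_j`.
[cite: Buchholz2016, Prop 3.1 (proof, "This condition implies Σ 𝒟_k = 𝒞")] -/
theorem sum_mix (L : ℝ) (γ N : ℕ) (c : ℕ → ℝ) :
    ∑ k ∈ Finset.Icc 1 (N + 1), mix L γ N c k = ∑ j ∈ Finset.Icc 1 (N + 1), c j := by
  unfold mix
  rw [Finset.sum_comm' (t' := Finset.Icc 1 (N + 1)) (s' := fun j => Finset.Icc j (N + 1))]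
  · refine sum_congr rfl fun j hj => ?_
    rw [Finset.mem_Icc] at hj
    rw [← Finset.sum_mul, sum_mixCoeff_col L γ N hj.2, one_mul]
  · intro k j
    simp only [Finset.mem_Icc]
    omega

/-! ## Positivity and lower bounds -/

/-- `𝒟_k ≥ 0` for a nonnegative family. [cite: Buchholz2016, Prop 3.1 (positivity)] -/
theorem mix_nonneg {L : ℝ} (hL : 5 ≤ L) {γ : ℕ} (hγ : 1 ≤ γ) (N : ℕ) {c : ℕ → ℝ} (hc : ∀ j, 1 ≤ j → 0 ≤ c j) (k : ℕ) :
    0 ≤ mix L γ N c k :=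
  sum_nonneg fun j hj => mul_nonneg (mixCoeff_nonneg hL hγ N k j) (hc j (Finset.mem_Icc.1 hj).1)

/-- `𝒟_k ≥ λ_{k,j} c_j` for a nonnegative family, `1 ≤ j ≤ k`. [cite: Buchholz2016, Prop 3.1 (3.10)–(3.12)] -/
theorem mixCoeff_mul_le_mix {L : ℝ} (hL : 5 ≤ L) {γ : ℕ} (hγ : 1 ≤ γ) (N : ℕ) {c : ℕ → ℝ}
    (hc : ∀ j, 1 ≤ j → 0 ≤ c j) {k j : ℕ} (hj : 1 ≤ j) (hjk : j ≤ k) : mixCoeff L γ N k j * c j ≤ mix L γ N c k := by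
  unfold mix
  exact Finset.single_le_sum (f := fun j => mixCoeff L γ N k j * c j)
    (fun j' hj' => mul_nonneg (mixCoeff_nonneg hL hγ N k j') (hc j' (Finset.mem_Icc.1 hj').1))
    (Finset.mem_Icc.2 ⟨hj, hjk⟩)

/-- `𝒟_k ≥ c_k/2` for a nonnegative family. [cite: Buchholz2016, Prop 3.1 (3.10)] -/
theorem half_mul_le_mix {L : ℝ} (hL : 5 ≤ L) {γ : ℕ} (hγ : 1 ≤ γ) (N : ℕ) {c : ℕ → ℝ}
    (hc : ∀ j, 1 ≤ j → 0 ≤ c j) {k : ℕ} (hk : 1 ≤ k) : c k / 2 ≤ mix L γ N c k := by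
  have h1 := mixCoeff_mul_le_mix hL hγ N hc hk le_rfl
  have h2 := (half_le_mixCoeff_self hL hγ N k).1
  have h3 := hc k hk
  nlinarith

/-- `𝒟_k ≥ L^{-(k-j)γ} c_j` for a nonnegative family, `1 ≤ j < k`. [cite: Buchholz2016, Prop 3.1 (3.11)] -/
theorem inv_pow_mul_le_mix {L : ℝ} (hL : 5 ≤ L) {γ : ℕ} (hγ : 1 ≤ γ) (N : ℕ) {c : ℕ → ℝ}
    (hc : ∀ j, 1 ≤ j → 0 ≤ c j) {k j : ℕ} (hj : 1 ≤ j) (hjk : j < k) :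
    (L ^ ((k - j) * γ))⁻¹ * c j ≤ mix L γ N c k := by
  have h := mixCoeff_mul_le_mix hL hγ N hc hj hjk.le
  rwa [mixCoeff_of_lt L γ N hjk] at h

/-! ## Upper bounds -/

/-- **(3.13)**: `|c_j| ≤ U L^{2j}` for `1 ≤ j ≤ k` implies `|𝒟_k| ≤ 2U L^{2k}`.
[cite: Buchholz2016, Prop 3.1 (3.13)] -/
theorem abs_mix_le_geom {L : ℝ} (hL : 5 ≤ L) {γ : ℕ} (hγ : 1 ≤ γ) (N : ℕ) {c : ℕ → ℝ} {U : ℝ} (hU : 0 ≤ U) {k : ℕ}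
    (hc : ∀ j, 1 ≤ j → j ≤ k → |c j| ≤ U * L ^ (2 * j)) : |mix L γ N c k| ≤ 2 * U * L ^ (2 * k) := by
  have hL1 : 1 ≤ L := by linarith
  have hL0 : 0 < L := by linarith
  unfold mix
  refine (abs_sum_le_sum_abs _ _).trans ?_
  have hterm : ∀ j ∈ Finset.Icc 1 k, |mixCoeff L γ N k j * c j| ≤ U * L ^ (2 * k) * (L ^ (k - j))⁻¹ := by
    intro j hj
    rw [Finset.mem_Icc] at hj
    rw [abs_mul, abs_of_nonneg (mixCoeff_nonneg hL hγ N k j)]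
    have h1 := mixCoeff_le_inv_pow hL hγ N hj.2
    have h2 := hc j hj.1 hj.2
    calc mixCoeff L γ N k j * |c j| ≤ (L ^ ((k - j) * γ))⁻¹ * (U * L ^ (2 * j)) :=
          mul_le_mul h1 h2 (abs_nonneg _) (by positivity)
      _ ≤ (L ^ (k - j))⁻¹ * (U * L ^ (2 * j)) := by
          refine mul_le_mul_of_nonneg_right ?_ (by positivity)
          rw [inv_le_inv₀ (by positivity) (by positivity)]
          exact pow_le_pow_right₀ hL1 (Nat.le_mul_of_pos_right _ hγ)
      _ ≤ (L ^ (k - j))⁻¹ * (U * L ^ (2 * k)) := by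
          have : L ^ (2 * j) ≤ L ^ (2 * k) := pow_le_pow_right₀ hL1 (by omega)
          gcongr
      _ = U * L ^ (2 * k) * (L ^ (k - j))⁻¹ := by ring
  refine (sum_le_sum hterm).trans ?_
  rw [← Finset.mul_sum]
  have hgeom : ∑ j ∈ Finset.Icc 1 k, (L ^ (k - j))⁻¹ ≤ 2 := by
    -- reindex `i = k - j`
    rw [← Finset.Ico_add_one_right_eq_Icc, Finset.sum_Ico_eq_sum_range, show k + 1 - 1 = k by omega]
    have : ∑ i ∈ Finset.range k, (L ^ (k - (1 + i)))⁻¹ = ∑ i ∈ Finset.range k, (L⁻¹) ^ (k - 1 - i) :=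
      sum_congr rfl fun i _ => by rw [inv_pow]; congr 2; omega
    rw [this, Finset.sum_range_reflect (fun i => (L⁻¹) ^ i) k]
    refine geom_sum_le_two (by positivity) ?_ k
    rw [inv_le_comm₀ hL0 (by norm_num)]; linarith
  calc U * L ^ (2 * k) * ∑ j ∈ Finset.Icc 1 k, (L ^ (k - j))⁻¹ ≤ U * L ^ (2 * k) * 2 :=
        mul_le_mul_of_nonneg_left hgeom (by positivity)
    _ = 2 * U * L ^ (2 * k) := by ring

/-- **(3.14)–(3.16), the annulus estimate**: let `j₀ < k`, `x > L^{-j₀-1}` (`x = |p|`, `p ∈ 𝔸_{j₀}`), and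
suppose `|c_{k'}| ≤ U L^{2k'}` and `|c_{k'}| ≤ U x^{-2} (x L^{k'-1})^{-(γ+1)}` for `1 ≤ k' ≤ k`.  Then
`|𝒟_k| ≤ 4U L^{2γ+3} L^{2j₀} L^{-(k-j₀)γ}` (with `γ = d−1+n`, `γ+1 = d+n = n̄`, `2γ+3 = 2(d+n)+1`).
[cite: Buchholz2016, Prop 3.1 (3.14)–(3.16)] -/
theorem abs_mix_le_decay {L : ℝ} (hL : 5 ≤ L) {γ : ℕ} (hγ : 1 ≤ γ) (N : ℕ) {c : ℕ → ℝ} {U x : ℝ} (hU : 0 ≤ U)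
    (hx : 0 < x) {k j₀ : ℕ} (hj₀k : j₀ < k) (hxlow : (L ^ (j₀ + 1))⁻¹ < x)
    (hc1 : ∀ k', 1 ≤ k' → k' ≤ k → |c k'| ≤ U * L ^ (2 * k'))
    (hc2 : ∀ k', 1 ≤ k' → k' ≤ k → |c k'| ≤ U / (x ^ 2 * (x * L ^ (k' - 1)) ^ (γ + 1))) :
    |mix L γ N c k| ≤ 4 * U * L ^ (2 * γ + 3) * L ^ (2 * j₀) / L ^ ((k - j₀) * γ) := by
  have hL1 : 1 ≤ L := by linarith
  have hL0 : 0 < L := by linarith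
  unfold mix
  -- split the sum at `j₀`
  rw [← Finset.sum_filter_add_sum_filter_not (Finset.Icc 1 k) (fun k' => k' ≤ j₀)]
  have hS1 : (Finset.Icc 1 k).filter (fun k' => k' ≤ j₀) = Finset.Icc 1 j₀ := by
    ext k'; simp only [Finset.mem_filter, Finset.mem_Icc]; omega
  have hS2 : (Finset.Icc 1 k).filter (fun k' => ¬k' ≤ j₀) = Finset.Icc (j₀ + 1) k := by
    ext k'; simp only [Finset.mem_filter, Finset.mem_Icc]; omega
  rw [hS1, hS2]
  refine (abs_add_le _ _).trans ?_
  -- first part: `Σ_{k' ≤ j₀} L^{-(k-k')γ} U L^{2k'} ≤ 2U L^{2j₀} L^{-(k-j₀)γ}`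
  have hA : |∑ k' ∈ Finset.Icc 1 j₀, mixCoeff L γ N k k' * c k'| ≤ 2 * U * L ^ (2 * j₀) / L ^ ((k - j₀) * γ) := by
    refine (abs_sum_le_sum_abs _ _).trans ?_
    have hterm : ∀ k' ∈ Finset.Icc 1 j₀, |mixCoeff L γ N k k' * c k'| ≤
        U * L ^ (2 * j₀) / L ^ ((k - j₀) * γ) * (L ^ (j₀ - k'))⁻¹ := by
      intro k' hk'
      rw [Finset.mem_Icc] at hk'
      rw [abs_mul, abs_of_nonneg (mixCoeff_nonneg hL hγ N k k'), mixCoeff_of_lt L γ N (by omega)]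
      have h2 := hc1 k' hk'.1 (by omega)
      have hsplit : (L ^ ((k - k') * γ))⁻¹ = (L ^ ((k - j₀) * γ))⁻¹ * (L ^ ((j₀ - k') * γ))⁻¹ := by
        rw [← mul_inv, ← pow_add, ← Nat.add_mul]
        congr 3; omega
      have hsplit2 : L ^ (2 * k') * L ^ (2 * (j₀ - k')) = L ^ (2 * j₀) := by
        rw [← pow_add]; congr 1; omega
      calc (L ^ ((k - k') * γ))⁻¹ * |c k'| ≤ (L ^ ((k - k') * γ))⁻¹ * (U * L ^ (2 * k')) :=
            mul_le_mul_of_nonneg_left h2 (by positivity)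
        _ = U * L ^ (2 * k') * (L ^ ((k - j₀) * γ))⁻¹ * (L ^ ((j₀ - k') * γ))⁻¹ := by rw [hsplit]; ring
        _ ≤ U * L ^ (2 * k') * (L ^ ((k - j₀) * γ))⁻¹ * (L ^ (j₀ - k'))⁻¹ := by
            refine mul_le_mul_of_nonneg_left ?_ (by positivity)
            rw [inv_le_inv₀ (by positivity) (by positivity)]
            exact pow_le_pow_right₀ hL1 (Nat.le_mul_of_pos_right _ hγ)
        _ ≤ U * (L ^ (2 * k') * L ^ (2 * (j₀ - k'))) * (L ^ ((k - j₀) * γ))⁻¹ * (L ^ (j₀ - k'))⁻¹ := by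
            gcongr
            exact le_mul_of_one_le_right (by positivity) (one_le_pow₀ hL1)
        _ = U * L ^ (2 * j₀) / L ^ ((k - j₀) * γ) * (L ^ (j₀ - k'))⁻¹ := by rw [hsplit2]; ring
    refine (sum_le_sum hterm).trans ?_
    rw [← Finset.mul_sum]
    have hgeom : ∑ k' ∈ Finset.Icc 1 j₀, (L ^ (j₀ - k'))⁻¹ ≤ 2 := by
      rw [← Finset.Ico_add_one_right_eq_Icc, Finset.sum_Ico_eq_sum_range, show j₀ + 1 - 1 = j₀ by omega]
      have : ∑ i ∈ Finset.range j₀, (L ^ (j₀ - (1 + i)))⁻¹ = ∑ i ∈ Finset.range j₀, (L⁻¹) ^ (j₀ - 1 - i) :=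
        sum_congr rfl fun i _ => by rw [inv_pow]; congr 2; omega
      rw [this, Finset.sum_range_reflect (fun i => (L⁻¹) ^ i) j₀]
      refine geom_sum_le_two (by positivity) ?_ j₀
      rw [inv_le_comm₀ hL0 (by norm_num)]; linarith
    calc U * L ^ (2 * j₀) / L ^ ((k - j₀) * γ) * ∑ k' ∈ Finset.Icc 1 j₀, (L ^ (j₀ - k'))⁻¹
        ≤ U * L ^ (2 * j₀) / L ^ ((k - j₀) * γ) * 2 := mul_le_mul_of_nonneg_left hgeom (by positivity)
      _ = 2 * U * L ^ (2 * j₀) / L ^ ((k - j₀) * γ) := by ring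
  -- second part: `Σ_{k'=j₀+1}^{k} L^{-(k-k')γ} U x^{-2} (x L^{k'-1})^{-(γ+1)} ≤ 2U L^{2γ+3} L^{2j₀} L^{-(k-j₀)γ}`
  have hB : |∑ k' ∈ Finset.Icc (j₀ + 1) k, mixCoeff L γ N k k' * c k'| ≤
      2 * U * L ^ (2 * γ + 3) * L ^ (2 * j₀) / L ^ ((k - j₀) * γ) := by
    refine (abs_sum_le_sum_abs _ _).trans ?_
    -- `x^{-1} < L^{j₀+1}`
    have hxi : x⁻¹ < L ^ (j₀ + 1) := by
      have := hxlow; rwa [inv_lt_comm₀ (by positivity) hx] at this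
    have hterm : ∀ k' ∈ Finset.Icc (j₀ + 1) k, |mixCoeff L γ N k k' * c k'| ≤
        U * L ^ (2 * γ + 3) * L ^ (2 * j₀) / L ^ ((k - j₀) * γ) * (L ^ (k' - (j₀ + 1)))⁻¹ := by
      intro k' hk'
      rw [Finset.mem_Icc] at hk'
      rw [abs_mul, abs_of_nonneg (mixCoeff_nonneg hL hγ N k k')]
      have h1 := mixCoeff_le_inv_pow hL hγ N hk'.2
      have h2 := hc2 k' (by omega) hk'.2
      -- `U/(x² (x L^{k'-1})^{γ+1}) = U x^{-(γ+3)} L^{-(k'-1)(γ+1)} ≤ U L^{(j₀+1)(γ+3)} L^{-(k'-1)(γ+1)}`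
      have h3 : U / (x ^ 2 * (x * L ^ (k' - 1)) ^ (γ + 1)) ≤ U * (L ^ (j₀ + 1)) ^ (γ + 3) / (L ^ (k' - 1)) ^ (γ + 1) := by
        have hP : 0 < (L ^ (k' - 1)) ^ (γ + 1) := by positivity
        calc U / (x ^ 2 * (x * L ^ (k' - 1)) ^ (γ + 1)) = U / (L ^ (k' - 1)) ^ (γ + 1) * x⁻¹ ^ (γ + 3) := by
              rw [mul_pow, inv_pow]; field_simp; ring
          _ ≤ U / (L ^ (k' - 1)) ^ (γ + 1) * (L ^ (j₀ + 1)) ^ (γ + 3) :=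
              mul_le_mul_of_nonneg_left (pow_le_pow_left₀ (by positivity) hxi.le _) (by positivity)
          _ = U * (L ^ (j₀ + 1)) ^ (γ + 3) / (L ^ (k' - 1)) ^ (γ + 1) := by ring
      calc mixCoeff L γ N k k' * |c k'|
          ≤ (L ^ ((k - k') * γ))⁻¹ * (U * (L ^ (j₀ + 1)) ^ (γ + 3) / (L ^ (k' - 1)) ^ (γ + 1)) :=
            mul_le_mul h1 (h2.trans h3) (abs_nonneg _) (by positivity)
        _ = U * L ^ (2 * γ + 3) * L ^ (2 * j₀) / L ^ ((k - j₀) * γ) * (L ^ (k' - (j₀ + 1)))⁻¹ := by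
            -- pure exponent bookkeeping: both sides are `U · L^{e}` with the same `e`
            obtain ⟨i, rfl⟩ : ∃ i, k' = j₀ + 1 + i := ⟨k' - (j₀ + 1), by omega⟩
            obtain ⟨m, rfl⟩ : ∃ m, k = j₀ + 1 + i + m := ⟨k - (j₀ + 1 + i), by omega⟩
            rw [show j₀ + 1 + i + m - (j₀ + 1 + i) = m by omega, show j₀ + 1 + i - 1 = j₀ + i by omega,
              show j₀ + 1 + i + m - j₀ = 1 + i + m by omega, show j₀ + 1 + i - (j₀ + 1) = i by omega,
              ← pow_mul, ← pow_mul]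
            field_simp
            ring
    refine (sum_le_sum hterm).trans ?_
    rw [← Finset.mul_sum]
    have hgeom : ∑ k' ∈ Finset.Icc (j₀ + 1) k, (L ^ (k' - (j₀ + 1)))⁻¹ ≤ 2 := by
      rw [← Finset.Ico_add_one_right_eq_Icc, Finset.sum_Ico_eq_sum_range]
      have : ∑ i ∈ Finset.range (k + 1 - (j₀ + 1)), (L ^ (j₀ + 1 + i - (j₀ + 1)))⁻¹ =
          ∑ i ∈ Finset.range (k + 1 - (j₀ + 1)), (L⁻¹) ^ i :=
        sum_congr rfl fun i _ => by rw [show j₀ + 1 + i - (j₀ + 1) = i by omega, inv_pow]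
      rw [this]
      refine geom_sum_le_two (by positivity) ?_ _
      rw [inv_le_comm₀ hL0 (by norm_num)]; linarith
    calc U * L ^ (2 * γ + 3) * L ^ (2 * j₀) / L ^ ((k - j₀) * γ) * ∑ k' ∈ Finset.Icc (j₀ + 1) k, (L ^ (k' - (j₀ + 1)))⁻¹
        ≤ U * L ^ (2 * γ + 3) * L ^ (2 * j₀) / L ^ ((k - j₀) * γ) * 2 := mul_le_mul_of_nonneg_left hgeom (by positivity)
      _ = 2 * U * L ^ (2 * γ + 3) * L ^ (2 * j₀) / L ^ ((k - j₀) * γ) := by ring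
  -- combine, using `1 ≤ L^{2γ+3}`
  have hL23 : (1 : ℝ) ≤ L ^ (2 * γ + 3) := one_le_pow₀ hL1
  have h0 : 0 ≤ 2 * U * L ^ (2 * j₀) / L ^ ((k - j₀) * γ) := by positivity
  calc |∑ k' ∈ Finset.Icc 1 j₀, mixCoeff L γ N k k' * c k'| + |∑ k' ∈ Finset.Icc (j₀ + 1) k, mixCoeff L γ N k k' * c k'|
      ≤ 2 * U * L ^ (2 * j₀) / L ^ ((k - j₀) * γ) + 2 * U * L ^ (2 * γ + 3) * L ^ (2 * j₀) / L ^ ((k - j₀) * γ) :=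
        add_le_add hA hB
    _ ≤ 2 * U * L ^ (2 * γ + 3) * L ^ (2 * j₀) / L ^ ((k - j₀) * γ) +
        2 * U * L ^ (2 * γ + 3) * L ^ (2 * j₀) / L ^ ((k - j₀) * γ) := by
        refine add_le_add ?_ le_rfl
        have : 2 * U * L ^ (2 * γ + 3) * L ^ (2 * j₀) / L ^ ((k - j₀) * γ) =
            L ^ (2 * γ + 3) * (2 * U * L ^ (2 * j₀) / L ^ ((k - j₀) * γ)) := by ring
        rw [this]
        exact le_mul_of_one_le_left h0 hL23
    _ = 4 * U * L ^ (2 * γ + 3) * L ^ (2 * j₀) / L ^ ((k - j₀) * γ) := by ring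

end Literature.MathematicalPhysics.StatisticalMechanics.GradientFRD

end
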